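import Summits.BirchSwinnertonDyer.Rank1Residual.X2.GreenbergVatsalReductionDatum
import Literature.NumberTheory.EllipticCurves.SpectralValuationUnramified
import HarnessLib

/-!
# Units under a (twisted) Tate parametrisation `Ψ : K̄_vˣ → E(K̄_v)`: the image `A₁ = Ψ(𝒪̄ˣ)` is
# `Γ_{K_v}`-stable, divisible, with torsion quotient, `A₁[p] = ⟨Ψ(ζ_p)⟩`, and a sign-flipping
# `σ` moves `E[p]/A₁[p]` (team n1011, row T-T3M, seat p12 GEN 9; file F1-M — the local algebra in
# `K̄_vˣ` feeding the model-free END `Additive/LocalTowerKernelAtPOfStableSubgroup`)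

HONEST FRAMING (cell `b2b-bsdres`, run/shared/lean/b2b/bsd-rank1-residual/, verbatim in every
file): the goal of the cell is to DELETE the COMBINATION-SHAPED residual classes of the
Birch–Swinnerton-Dyer formula for ALL analytic-rank `≤ 1` elliptic curves over `ℚ` — "full BSD
formula for every rank `≤ 1` curve in class `C`" assembled STRICTLY from published theorems — so
that the rank-`≤ 1` remainder becomes exactly the CONSTRUCTION-SHAPED classes, which are TYPED
(missing-input `Prop`s), NOT attempted. This is not "finishing BSD". Team n1011 (N10/N11; row
T-T3M = the (M) sibling of T-T3B, skeleton `cells/n1011/skel/T-T3M.md`): research routes on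
CONSTRUCTION-SHAPED classes; prove what is provable now; no claim beyond stated classes; census
output = EVIDENCE, never a Literature fact; RESIDUAL-MAP marks UNCHANGED; nothing is booked by this
file. TOOL THEOREMS ONLY: no definition, no named fact, nothing cited enters as a hypothesis. The
parametrisation `Ψ` is DATA here (any additive map `K̄_vˣ → E(K̄_v)` with kernel `q^ℤ` and
`Γ_{K_v}`-equivariance up to sign); the row's END feeds it from the PUBLISHED Tate uniformisation
(A40/A41, Silverman *ATAEC* V.3.1 / V.5.3 / V.5.4) of the `p*`-twist model, transported.

## What

`K` a number field, `v` a finite place, `K̄_v` with its spectral valuation `|·|_v` (`specVal v`),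
`E = W`, `Ψ : K̄_vˣ →+ E(K̄_v)` (written on `Additive K̄_vˣ`) with kernel `q^ℤ` (`0 < |q|_v < 1`,
`hker`) and `σ • Ψ(u) = ±Ψ(σu)` (`hsign`, X2's `tateDatum` shape), and a subgroup `A₁ ≤ E(K̄_v)`
CHARACTERISED as the image of the units, `P ∈ A₁ ↔ ∃ u, |u|_v = 1 ∧ Ψ u = P` (`hA₁`; such a
subgroup exists, `exists_unitsImage` — no definition is introduced). Then (§2):
* `smul_mem_of_sign` — `A₁` is `Γ_{K_v}`-stable (`|σu|_v = |u|_v`);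
* `exists_mem_nsmul_eq` — `A₁` is `n`-divisible for every `n > 0` (`K̄_v` algebraically closed,
  `|z|ⁿ = 1 ⇒ |z| = 1`);
* `exists_nsmul_mem` — every point has a positive multiple in `A₁`: `|u|_v^d = ‖a₀‖` for the
  constant coefficient `a₀` of the minimal polynomial of `u` over `K_v` (Mathlib
  `spectralNorm_eq_norm_coeff_zero_rpow`), `|K_vˣ|_v = |ϖ|_v^ℤ`, `|q|_v = |ϖ|_v^k` with `k ≥ 1`
  (tree `exists_spectralValuation_algebraMap_eq_pow`), so `u^{dk} q^{−j}` is a unit;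
* `exists_generator_torsion` — `A₁ ∩ E[p] = ⟨Ψ(ζ_p)⟩` with `Ψ(ζ_p)` of order exactly `p`
  (a unit `q`-power is `1`: `|q|_v < 1`);
* `exists_psmul_eq_zero_sub_notMem_of_sign_neg` — if `σ • Ψ(u) = −Ψ(σu)` for all `u` and `p` is
  odd, then `P = Ψ(q^{1/p}) ∈ E[p]` has `σP − P = −Ψ(σ(q^{1/p}) q^{1/p}) ∉ A₁`
  (`|q|_v^{2/p} ∉ |q|_v^ℤ`).
These are the hypotheses `hA₁ hdiv₁ htor hP₁ hP₁ord hK hmove` of F2-M's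
`StableSubgroupLine.localTowerKerPrimary_zero_eq_bot_of_stableSubgroup` for the Tate instance.

References: [SilvermanATAEC1994] *ATAEC* V.3.1, V.4.1, V.5.3–5.4 (`E_q(K̄) ≅ K̄ˣ/q^ℤ`,
`E_q[p] = ⟨ζ_p, q^{1/p}⟩`); [GreenbergLNM1716] §3 pp. 92–93; [NeukirchANT1999] II (4.8), (6.2).
-/

noncomputable section

open scoped Classical NNReal Valued

open WeierstrassCurve

universe u
namespace Summit.BirchSwinnertonDyer.Rank1Residual.Iwasawa.TateUnits

open NumberField IsDedekindDomain Field IsDedekindDomain.HeightOneSpectrum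
  Literature.NumberTheory.GaloisRepresentations
  Literature.NumberTheory.EllipticCurves
  Summit.BirchSwinnertonDyer.Rank1Residual.X2.GreenbergVatsalReductionDatum

variable {K : Type u} [Field K] [NumberField K] {v : HeightOneSpectrum (𝓞 K)}

/-! ## §1 The spectral valuation: Galois invariance and the value group -/

/-- `|σ • x|_v = |x|_v` for `σ ∈ Γ_{K_v}` (tree `spectralValuation_smul` for the chosen `specVal v`).
[cite: NeukirchANT1999, Ch. II Thm. (4.8)] -/
theorem specVal_smul (σ : absoluteGaloisGroup (v.adicCompletion K))
    (x : AlgebraicClosure (v.adicCompletion K)) : specVal v (σ • x) = specVal v x :=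
  spectralValuation_smul (specVal_spec v) σ x

/-- `|σ u|_v = |u|_v` for a unit `u ∈ K̄_vˣ` moved by `σ ∈ Γ_{K_v}` through `Units.map`.
[cite: NeukirchANT1999, Ch. II Thm. (4.8)] -/
theorem specVal_units_map (σ : absoluteGaloisGroup (v.adicCompletion K))
    (u : (AlgebraicClosure (v.adicCompletion K))ˣ) :
    specVal v ((Units.map (Field.absoluteGaloisGroup.toAlgEquiv (v.adicCompletion K) σ :
        AlgebraicClosure (v.adicCompletion K) →* AlgebraicClosure (v.adicCompletion K)) u :
          (AlgebraicClosure (v.adicCompletion K))ˣ) : AlgebraicClosure (v.adicCompletion K)) =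
      specVal v (u : AlgebraicClosure (v.adicCompletion K)) := by
  rw [Units.coe_map]
  exact specVal_smul σ (u : AlgebraicClosure (v.adicCompletion K))

/-- `0 < |q|_v < 1` in `K̄_v` for `q ∈ K_v` with `q ≠ 0`, `v(q) < 1`. [folklore] -/
theorem specVal_algebraMap_pos_lt_one {q : v.adicCompletion K} (hq0 : q ≠ 0) (hq1 : Valued.v q < 1) :
    0 < specVal v (algebraMap (v.adicCompletion K) (AlgebraicClosure (v.adicCompletion K)) q) ∧
      specVal v (algebraMap (v.adicCompletion K) (AlgebraicClosure (v.adicCompletion K)) q) < 1 := by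
  refine ⟨?_, ?_⟩
  · rw [Valuation.pos_iff, map_ne_zero_iff _ (FaithfulSMul.algebraMap_injective _ _)]
    exact hq0
  · rw [← NNReal.coe_lt_coe, coe_spectralValuation_algebraMap (specVal_spec v), NNReal.coe_one]
    exact Valued.toNormedField.norm_lt_one_iff.mpr hq1

/-- **The value group of `K_v` is `|ϖ|_v^ℤ`**: every `a ∈ K_vˣ` has `|a|_v = |ϖ|_v^m` for some
`m ∈ ℤ` (`ϖ` a uniformiser of `𝓞_v`). [cite: NeukirchANT1999, Ch. II Prop. (3.8) and (4.8)] -/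
theorem exists_specVal_algebraMap_eq_zpow {ϖ : v.adicCompletionIntegers K} (hϖ : Irreducible ϖ)
    {a : v.adicCompletion K} (ha : a ≠ 0) :
    ∃ m : ℤ, specVal v (algebraMap (v.adicCompletion K) (AlgebraicClosure (v.adicCompletion K)) a) =
      specVal v (algebraMap (v.adicCompletion K) (AlgebraicClosure (v.adicCompletion K))
        (ϖ : v.adicCompletion K)) ^ m := by
  set f := algebraMap (v.adicCompletion K) (AlgebraicClosure (v.adicCompletion K)) with hf
  have hw := specVal_spec v
  have ha0 : 0 < specVal v (f a) := by
    rw [Valuation.pos_iff, map_ne_zero_iff _ (FaithfulSMul.algebraMap_injective _ _)]; exact ha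
  rcases lt_trichotomy (specVal v (f a)) 1 with hlt | heq | hgt
  · obtain ⟨m, -, hm⟩ := exists_spectralValuation_algebraMap_eq_pow hw hϖ ha0 hlt
    exact ⟨m, by rw [zpow_natCast]; exact hm⟩
  · exact ⟨0, by rw [zpow_zero]; exact heq⟩
  · have hai : a⁻¹ ≠ 0 := inv_ne_zero ha
    have h0 : 0 < specVal v (f a⁻¹) := by
      rw [Valuation.pos_iff, map_ne_zero_iff _ (FaithfulSMul.algebraMap_injective _ _)]; exact hai
    have h1 : specVal v (f a⁻¹) < 1 := by
      rw [map_inv₀, map_inv₀]; exact inv_lt_one_of_one_lt₀ hgt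
    obtain ⟨m, -, hm⟩ := exists_spectralValuation_algebraMap_eq_pow hw hϖ h0 h1
    refine ⟨-(m : ℤ), ?_⟩
    rw [map_inv₀, map_inv₀] at hm
    rw [zpow_neg, zpow_natCast, ← hm, inv_inv]

/-- **`|u|_v^d ∈ |K_vˣ|_v` for `u ∈ K̄_vˣ`**: with `d` the degree and `a₀ ≠ 0` the constant
coefficient of the minimal polynomial of `u` over `K_v`, `|u|_v^d = |a₀|_v` (Mathlib: the spectral
norm is `‖a₀‖^{1/d}`). [cite: NeukirchANT1999, Ch. II Thm. (4.8)] -/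
theorem exists_pow_specVal_eq_specVal_algebraMap {u : AlgebraicClosure (v.adicCompletion K)}
    (hu : u ≠ 0) :
    ∃ d : ℕ, 0 < d ∧ ∃ a : v.adicCompletion K, a ≠ 0 ∧
      specVal v u ^ d =
        specVal v (algebraMap (v.adicCompletion K) (AlgebraicClosure (v.adicCompletion K)) a) := by
  have hint : IsIntegral (v.adicCompletion K) u := Algebra.IsIntegral.isIntegral u
  have hd : 0 < (minpoly (v.adicCompletion K) u).natDegree := minpoly.natDegree_pos hint
  have ha0 : (minpoly (v.adicCompletion K) u).coeff 0 ≠ 0 := minpoly.coeff_zero_ne_zero hint hu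
  refine ⟨_, hd, _, ha0, ?_⟩
  have key : (specVal v u : ℝ) ^ (minpoly (v.adicCompletion K) u).natDegree =
      ‖(minpoly (v.adicCompletion K) u).coeff 0‖ := by
    rw [specVal_spec, spectralNorm.spectralNorm_eq_norm_coeff_zero_rpow (v.adicCompletion K)
      (AlgebraicClosure (v.adicCompletion K)) u, one_div,
      Real.rpow_inv_natCast_pow (norm_nonneg _) hd.ne']
  apply NNReal.coe_injective
  rw [NNReal.coe_pow, key, coe_spectralValuation_algebraMap (specVal_spec v)]

/-- **Every `|u|_v`, `u ∈ K̄_vˣ`, is rationally a power of `|q|_v`** (`0 < |q|_v < 1`, `q ∈ K_v`):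
`|u|_v^n = |q|_v^j` for some `n > 0`, `j ∈ ℤ`. [cite: NeukirchANT1999, Ch. II Thm. (4.8)] -/
theorem exists_pow_specVal_eq_zpow {q : v.adicCompletion K} (hq0 : q ≠ 0) (hq1 : Valued.v q < 1)
    {u : AlgebraicClosure (v.adicCompletion K)} (hu : u ≠ 0) :
    ∃ n : ℕ, 0 < n ∧ ∃ j : ℤ, specVal v u ^ n =
      specVal v (algebraMap (v.adicCompletion K) (AlgebraicClosure (v.adicCompletion K)) q) ^ j := by
  obtain ⟨ϖ, hϖ⟩ := IsDiscreteValuationRing.exists_irreducible (v.adicCompletionIntegers K)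
  obtain ⟨d, hd, a, ha, hda⟩ := exists_pow_specVal_eq_specVal_algebraMap (v := v) hu
  obtain ⟨m, hm⟩ := exists_specVal_algebraMap_eq_zpow hϖ ha
  obtain ⟨hq0', hq1'⟩ := specVal_algebraMap_pos_lt_one (v := v) hq0 hq1
  obtain ⟨k, hk, hqk⟩ := exists_spectralValuation_algebraMap_eq_pow (specVal_spec v) hϖ hq0' hq1'
  refine ⟨d * k, Nat.mul_pos hd (by omega), m, ?_⟩
  rw [pow_mul, hda, hm, hqk, ← zpow_natCast, ← zpow_mul, ← zpow_natCast, ← zpow_mul, mul_comm]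

/-- `|q|_v^a = |q|_v^b ⇒ a = b` for `0 < |q|_v < 1`. [folklore] -/
theorem zpow_specVal_injective {q : v.adicCompletion K} (hq0 : q ≠ 0) (hq1 : Valued.v q < 1)
    {a b : ℤ} (h : specVal v (algebraMap (v.adicCompletion K) (AlgebraicClosure (v.adicCompletion K)) q) ^ a =
      specVal v (algebraMap (v.adicCompletion K) (AlgebraicClosure (v.adicCompletion K)) q) ^ b) :
    a = b := by
  obtain ⟨hq0', hq1'⟩ := specVal_algebraMap_pos_lt_one (v := v) hq0 hq1
  exact zpow_right_injective₀ hq0' hq1'.ne h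

/-- A unit of `K̄_v` which is a power of `q` is `q⁰ = 1`. [cite: SilvermanATAEC1994, Ch. V Thm. 3.1 (c)] -/
theorem eq_zero_of_specVal_eq_one_of_eq_zpow {q : v.adicCompletion K} (hq0 : q ≠ 0)
    (hq1 : Valued.v q < 1) {u : AlgebraicClosure (v.adicCompletion K)} (hu : specVal v u = 1) {n : ℤ}
    (hn : u = algebraMap (v.adicCompletion K) (AlgebraicClosure (v.adicCompletion K)) q ^ n) :
    n = 0 ∧ u = 1 := by
  have h : specVal v (algebraMap (v.adicCompletion K) (AlgebraicClosure (v.adicCompletion K)) q) ^ n =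
      specVal v (algebraMap (v.adicCompletion K) (AlgebraicClosure (v.adicCompletion K)) q) ^ (0 : ℤ) := by
    rw [zpow_zero, ← map_zpow₀, ← hn, hu]
  have hn0 := zpow_specVal_injective hq0 hq1 h
  exact ⟨hn0, by rw [hn, hn0, zpow_zero]⟩

/-! ## §2 The units image `A₁ = Ψ(𝒪̄ˣ)` -/
section Units

variable (W : WeierstrassCurve K)
  (Ψ : Additive (AlgebraicClosure (v.adicCompletion K))ˣ →+ localPoints W (v.adicCompletion K))

/-- **The units image exists as a subgroup**: there is `A₁ ≤ E(K̄_v)` with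
`P ∈ A₁ ↔ ∃ u ∈ K̄_vˣ, |u|_v = 1 ∧ Ψ u = P` (the image under `Ψ` of the kernel of `|·|_v` on
`K̄_vˣ`). Stated as an existence so that no definition is introduced; every later lemma takes the
characterisation `hA₁` as a hypothesis. [folklore] -/
theorem exists_unitsImage :
    ∃ A₁ : AddSubgroup (localPoints W (v.adicCompletion K)),
      ∀ P, P ∈ A₁ ↔ ∃ u : (AlgebraicClosure (v.adicCompletion K))ˣ,
        specVal v (u : AlgebraicClosure (v.adicCompletion K)) = 1 ∧ Ψ (Additive.ofMul u) = P := by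
  let U : AddSubgroup (Additive (AlgebraicClosure (v.adicCompletion K))ˣ) :=
    { carrier := {x | specVal v ((Additive.toMul x : (AlgebraicClosure (v.adicCompletion K))ˣ) :
        AlgebraicClosure (v.adicCompletion K)) = 1}
      zero_mem' := by simp
      add_mem' := fun {x y} hx hy ↦ by
        simp only [Set.mem_setOf_eq, toMul_add, Units.val_mul, map_mul] at hx hy ⊢
        rw [hx, hy, mul_one]
      neg_mem' := fun {x} hx ↦ by
        simp only [Set.mem_setOf_eq, toMul_neg, Units.val_inv_eq_inv_val, map_inv₀] at hx ⊢
        rw [hx, inv_one] }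
  refine ⟨U.map Ψ, fun P ↦ ⟨fun hP ↦ ?_, fun ⟨u, hu, huP⟩ ↦ ?_⟩⟩
  · obtain ⟨x, hx, rfl⟩ := AddSubgroup.mem_map.mp hP
    exact ⟨Additive.toMul x, hx, rfl⟩
  · exact AddSubgroup.mem_map.mpr ⟨Additive.ofMul u, hu, huP⟩

variable {W Ψ} {A₁ : AddSubgroup (localPoints W (v.adicCompletion K))}
  (hA₁ : ∀ P, P ∈ A₁ ↔ ∃ u : (AlgebraicClosure (v.adicCompletion K))ˣ,
    specVal v (u : AlgebraicClosure (v.adicCompletion K)) = 1 ∧ Ψ (Additive.ofMul u) = P)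

include hA₁ in
/-- **`A₁ = Ψ(𝒪̄ˣ)` is `Γ_{K_v}`-stable** when `σ • Ψ(u) = ±Ψ(σu)` (`hsign`, the shape of X2's
`tateDatum`): `|σu|_v = |u|_v`, and `−Ψ(σu) = Ψ((σu)⁻¹)`.
[cite: SilvermanATAEC1994, Ch. V Thm. 3.1 (d) and Lemma 5.2 (c)] -/
theorem smul_mem_of_sign
    (hsign : ∀ (σ : absoluteGaloisGroup (v.adicCompletion K))
      (u : (AlgebraicClosure (v.adicCompletion K))ˣ),
      σ • Ψ (Additive.ofMul u) = Ψ (Additive.ofMul (Units.map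
        (Field.absoluteGaloisGroup.toAlgEquiv (v.adicCompletion K) σ :
          AlgebraicClosure (v.adicCompletion K) →* AlgebraicClosure (v.adicCompletion K)) u)) ∨
      σ • Ψ (Additive.ofMul u) = -Ψ (Additive.ofMul (Units.map
        (Field.absoluteGaloisGroup.toAlgEquiv (v.adicCompletion K) σ :
          AlgebraicClosure (v.adicCompletion K) →* AlgebraicClosure (v.adicCompletion K)) u)))
    (σ : absoluteGaloisGroup (v.adicCompletion K)) (P : localPoints W (v.adicCompletion K))
    (hP : P ∈ A₁) : σ • P ∈ A₁ := by
  obtain ⟨u, hu, rfl⟩ := (hA₁ P).mp hP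
  rcases hsign σ u with h | h
  · exact (hA₁ _).mpr ⟨_, by rw [specVal_units_map, hu], h.symm⟩
  · refine (hA₁ _).mpr ⟨(Units.map (Field.absoluteGaloisGroup.toAlgEquiv (v.adicCompletion K) σ :
        AlgebraicClosure (v.adicCompletion K) →* AlgebraicClosure (v.adicCompletion K)) u)⁻¹, ?_, ?_⟩
    · rw [Units.val_inv_eq_inv_val, map_inv₀, specVal_units_map, hu, inv_one]
    · rw [ofMul_inv, map_neg, h]

include hA₁ in
/-- **`A₁ = Ψ(𝒪̄ˣ)` is `n`-divisible** (`n > 0`): `K̄_v` is algebraically closed, and an `n`-th root of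
a unit is a unit (`|z|_vⁿ = 1 ⇒ |z|_v = 1`). [cite: SilvermanATAEC1994, Ch. V Thm. 3.1 (c)] -/
theorem exists_mem_nsmul_eq {n : ℕ} (hn : 0 < n) (P : localPoints W (v.adicCompletion K))
    (hP : P ∈ A₁) : ∃ Q ∈ A₁, n • Q = P := by
  obtain ⟨u, hu, rfl⟩ := (hA₁ P).mp hP
  obtain ⟨z, hz⟩ := IsAlgClosed.exists_pow_nat_eq (u : AlgebraicClosure (v.adicCompletion K)) hn
  have hz0 : z ≠ 0 := by
    rintro rfl
    rw [zero_pow hn.ne'] at hz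
    exact u.ne_zero hz.symm
  have hzv : specVal v z = 1 := by
    have h : specVal v z ^ n = 1 := by rw [← map_pow, hz, hu]
    exact (pow_left_inj₀ zero_le zero_le hn.ne').mp (h.trans (one_pow n).symm)
  refine ⟨Ψ (Additive.ofMul (Units.mk0 z hz0)), (hA₁ _).mpr ⟨Units.mk0 z hz0, hzv, rfl⟩, ?_⟩
  rw [← map_nsmul, ← ofMul_pow]
  congr 2
  ext
  rw [Units.val_pow_eq_pow_val, Units.val_mk0, hz]

variable {q : v.adicCompletion K} (hq0 : q ≠ 0) (hq1 : Valued.v q < 1)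
  (hker : ∀ u : (AlgebraicClosure (v.adicCompletion K))ˣ, Ψ (Additive.ofMul u) = 0 ↔
    ∃ n : ℤ, (u : AlgebraicClosure (v.adicCompletion K)) =
      algebraMap (v.adicCompletion K) (AlgebraicClosure (v.adicCompletion K)) q ^ n)

include hq0 in
/-- The unit `q ∈ K̄_vˣ` (as an element of `Additive K̄_vˣ`) lies in the kernel of `Ψ`.
[cite: SilvermanATAEC1994, Ch. V Thm. 3.1 (c)] -/
theorem map_ofMul_mk0_algebraMap_eq_zero
    (hker : ∀ u : (AlgebraicClosure (v.adicCompletion K))ˣ, Ψ (Additive.ofMul u) = 0 ↔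
      ∃ n : ℤ, (u : AlgebraicClosure (v.adicCompletion K)) =
        algebraMap (v.adicCompletion K) (AlgebraicClosure (v.adicCompletion K)) q ^ n) :
    Ψ (Additive.ofMul (Units.mk0 (algebraMap (v.adicCompletion K)
      (AlgebraicClosure (v.adicCompletion K)) q)
        ((map_ne_zero_iff _ (FaithfulSMul.algebraMap_injective _ _)).mpr hq0))) = 0 :=
  (hker _).mpr ⟨1, by rw [Units.val_mk0, zpow_one]⟩

include hA₁ hq0 hq1 hker in
/-- **Every point has a positive multiple in `A₁ = Ψ(𝒪̄ˣ)`** (`Ψ` onto): for `P = Ψ u`,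
`|u|_v^n = |q|_v^j` (`exists_pow_specVal_eq_zpow`), so `uⁿ q^{−j}` is a unit and
`n • P = Ψ(uⁿ q^{−j}) ∈ A₁` (`Ψ q = 0`). The quotient `E(K̄_v)/A₁ ≅ |K̄_vˣ|_v / |q|_v^ℤ` is
torsion. [cite: SilvermanATAEC1994, Ch. V Thm. 3.1 (c)] [cite: GreenbergLNM1716, §3 pp. 92–93] -/
theorem exists_nsmul_mem (hsurj : Function.Surjective Ψ) (P : localPoints W (v.adicCompletion K)) :
    ∃ n : ℕ, 0 < n ∧ n • P ∈ A₁ := by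
  obtain ⟨x, rfl⟩ := hsurj P
  set u : (AlgebraicClosure (v.adicCompletion K))ˣ := Additive.toMul x with hu
  have hx : x = Additive.ofMul u := by rw [hu, ofMul_toMul]
  obtain ⟨n, hn, j, hj⟩ := exists_pow_specVal_eq_zpow (v := v) hq0 hq1 u.ne_zero
  have hq0' : algebraMap (v.adicCompletion K) (AlgebraicClosure (v.adicCompletion K)) q ≠ 0 :=
    (map_ne_zero_iff _ (FaithfulSMul.algebraMap_injective _ _)).mpr hq0
  set qu : (AlgebraicClosure (v.adicCompletion K))ˣ := Units.mk0 _ hq0' with hqu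
  refine ⟨n, hn, (hA₁ _).mpr ⟨u ^ n * qu ^ (-j), ?_, ?_⟩⟩
  · rw [Units.val_mul, Units.val_pow_eq_pow_val, Units.val_zpow_eq_zpow_val, Units.val_mk0, map_mul,
      map_pow, map_zpow₀, hj, ← zpow_add₀ (ne_of_gt (specVal_algebraMap_pos_lt_one hq0 hq1).1),
      add_neg_cancel, zpow_zero]
  · rw [ofMul_mul, ofMul_pow, ofMul_zpow, map_add, map_nsmul, map_zsmul, hx,
      map_ofMul_mk0_algebraMap_eq_zero hq0 hker, smul_zero, add_zero]

include hA₁ hq0 hq1 hker in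
/-- **`A₁ ∩ E[p] = ⟨Ψ(ζ_p)⟩` with `Ψ(ζ_p)` of order `p`**: a unit `u` with `Ψ(u^p) = 0` has
`u^p ∈ q^ℤ ∩ 𝒪̄ˣ = {1}`, so `u` is a power of a primitive `p`-th root of unity `ζ_p ∈ K̄_v`; and
`Ψ(ζ_p) ≠ 0` since `ζ_p ∉ q^ℤ`. (`E_q[p] ∩ (units) = μ_p`.)
[cite: SilvermanATAEC1994, Ch. V Thm. 3.1 (c) and §V.4] -/
theorem exists_generator_torsion (p : ℕ) [hp : Fact p.Prime] :
    ∃ P₁ ∈ A₁, addOrderOf P₁ = p ∧ ∀ P ∈ A₁, p • P = 0 → ∃ c : ℕ, P = c • P₁ := by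
  -- a primitive `p`-th root of unity in `K̄_v`
  haveI : CharZero (AlgebraicClosure (v.adicCompletion K)) := charZero_of_injective_algebraMap
    (algebraMap K (AlgebraicClosure (v.adicCompletion K))).injective
  haveI : NeZero ((p : ℕ) : AlgebraicClosure (v.adicCompletion K)) := NeZero.charZero
  obtain ⟨ζ, hζroot⟩ := IsAlgClosed.exists_root (Polynomial.cyclotomic p (AlgebraicClosure
      (v.adicCompletion K))) (by
    rw [Polynomial.degree_cyclotomic, Ne, Nat.cast_eq_zero]
    exact (Nat.totient_pos.mpr hp.out.pos).ne')
  have hζ : IsPrimitiveRoot ζ p := (Polynomial.isRoot_cyclotomic_iff).mp hζroot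
  have hζ0 : ζ ≠ 0 := hζ.ne_zero hp.out.ne_zero
  have hζv : specVal v ζ = 1 := by
    have h : specVal v ζ ^ p = 1 := by rw [← map_pow, hζ.pow_eq_one, map_one]
    exact (pow_left_inj₀ zero_le zero_le hp.out.ne_zero).mp (h.trans (one_pow p).symm)
  set ζu : (AlgebraicClosure (v.adicCompletion K))ˣ := Units.mk0 ζ hζ0 with hζu
  have hζup : ζu ^ p = 1 := by ext; rw [Units.val_pow_eq_pow_val, Units.val_mk0, hζ.pow_eq_one, Units.val_one]
  set P₁ := Ψ (Additive.ofMul ζu) with hP₁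
  have hP₁mem : P₁ ∈ A₁ := (hA₁ _).mpr ⟨ζu, hζv, rfl⟩
  have hpP₁ : p • P₁ = 0 := by rw [hP₁, ← map_nsmul, ← ofMul_pow, hζup, ofMul_one, map_zero]
  have hP₁ne : P₁ ≠ 0 := by
    intro h
    obtain ⟨n, hn⟩ := (hker ζu).mp h
    rw [Units.val_mk0] at hn
    obtain ⟨-, h1⟩ := eq_zero_of_specVal_eq_one_of_eq_zpow hq0 hq1 hζv hn
    exact hζ.ne_one hp.out.one_lt h1
  refine ⟨P₁, hP₁mem, addOrderOf_eq_prime hpP₁ hP₁ne, fun P hP hpP ↦ ?_⟩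
  obtain ⟨u, hu, rfl⟩ := (hA₁ P).mp hP
  -- `u^p ∈ q^ℤ` is a unit, hence `u^p = 1`
  have h0 : Ψ (Additive.ofMul (u ^ p)) = 0 := by rw [ofMul_pow, map_nsmul, hpP]
  obtain ⟨n, hn⟩ := (hker _).mp h0
  have hupv : specVal v ((u ^ p : (AlgebraicClosure (v.adicCompletion K))ˣ) :
      AlgebraicClosure (v.adicCompletion K)) = 1 := by
    rw [Units.val_pow_eq_pow_val, map_pow, hu, one_pow]
  obtain ⟨-, hup1⟩ := eq_zero_of_specVal_eq_one_of_eq_zpow hq0 hq1 hupv hn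
  rw [Units.val_pow_eq_pow_val] at hup1
  obtain ⟨i, -, hi⟩ := hζ.eq_pow_of_pow_eq_one hup1
  refine ⟨i, ?_⟩
  rw [hP₁, ← map_nsmul, ← ofMul_pow]
  congr 2
  ext
  rw [Units.val_pow_eq_pow_val, Units.val_mk0, hi]

include hA₁ hq0 hq1 hker in
/-- **A sign-flipping `σ` moves `E[p]` off `A₁`** (`p` odd): if `σ • Ψ(u) = −Ψ(σu)` for every `u`,
then for a `p`-th root `r` of `q` the point `P = Ψ(r) ∈ E[p]` has
`σP − P = −Ψ(σr · r) ∉ A₁ = Ψ(𝒪̄ˣ)`: otherwise `w · σr · r ∈ q^ℤ` for a unit `w`, and comparing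
valuations `|q|_v^{2/p} = |q|_v^n`, i.e. `2 = np`, impossible for odd `p`. This is the input
`hmove` of F2-M (the quotient `E(K̄_v)/A₁ ⊇ (ℚ_p/ℤ_p)(χ)` is MOVED by the sign character `χ`).
[cite: SilvermanATAEC1994, Ch. V §V.4 and Lemma 5.2 (c)] [cite: GreenbergLNM1716, §3 Lemma 3.4 (p. 89)] -/
theorem exists_psmul_eq_zero_sub_notMem_of_sign_neg (p : ℕ) [hp : Fact p.Prime] (hp2 : p ≠ 2)
    {σ : absoluteGaloisGroup (v.adicCompletion K)}
    (hσ : ∀ u : (AlgebraicClosure (v.adicCompletion K))ˣ,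
      σ • Ψ (Additive.ofMul u) = -Ψ (Additive.ofMul (Units.map
        (Field.absoluteGaloisGroup.toAlgEquiv (v.adicCompletion K) σ :
          AlgebraicClosure (v.adicCompletion K) →* AlgebraicClosure (v.adicCompletion K)) u))) :
    ∃ P : localPoints W (v.adicCompletion K), p • P = 0 ∧ σ • P - P ∉ A₁ := by
  have hq0' : algebraMap (v.adicCompletion K) (AlgebraicClosure (v.adicCompletion K)) q ≠ 0 :=
    (map_ne_zero_iff _ (FaithfulSMul.algebraMap_injective _ _)).mpr hq0
  obtain ⟨r, hr⟩ := IsAlgClosed.exists_pow_nat_eq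
    (algebraMap (v.adicCompletion K) (AlgebraicClosure (v.adicCompletion K)) q) hp.out.pos
  have hr0 : r ≠ 0 := by
    rintro rfl
    rw [zero_pow hp.out.ne_zero] at hr
    exact hq0' hr.symm
  set ru : (AlgebraicClosure (v.adicCompletion K))ˣ := Units.mk0 r hr0 with hru
  have hrup : ru ^ p = Units.mk0 _ hq0' := by
    ext; rw [Units.val_pow_eq_pow_val, Units.val_mk0, Units.val_mk0, hr]
  set σr : (AlgebraicClosure (v.adicCompletion K))ˣ := Units.map
    (Field.absoluteGaloisGroup.toAlgEquiv (v.adicCompletion K) σ :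
      AlgebraicClosure (v.adicCompletion K) →* AlgebraicClosure (v.adicCompletion K)) ru with hσr
  refine ⟨Ψ (Additive.ofMul ru), ?_, fun hmem ↦ ?_⟩
  · rw [← map_nsmul, ← ofMul_pow, hrup, map_ofMul_mk0_algebraMap_eq_zero hq0 hker]
  -- `σP − P = −Ψ(σr · r)`
  have hsub : σ • Ψ (Additive.ofMul ru) - Ψ (Additive.ofMul ru) = -Ψ (Additive.ofMul (σr * ru)) := by
    rw [hσ ru, ofMul_mul, map_add]; abel
  rw [hsub] at hmem
  obtain ⟨w, hw1, hw⟩ := (hA₁ _).mp hmem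
  have h0 : Ψ (Additive.ofMul (w * (σr * ru))) = 0 := by
    rw [ofMul_mul, map_add, hw, neg_add_cancel]
  obtain ⟨n, hn⟩ := (hker _).mp h0
  -- valuations: `|r|^2 = |q|^n`, `|r|^p = |q|`
  have hrv : specVal v r ^ p =
      specVal v (algebraMap (v.adicCompletion K) (AlgebraicClosure (v.adicCompletion K)) q) := by
    rw [← map_pow, hr]
  have hval : specVal v r ^ 2 =
      specVal v (algebraMap (v.adicCompletion K) (AlgebraicClosure (v.adicCompletion K)) q) ^ n := by
    have h := congrArg (specVal v) hn
    rw [Units.val_mul, Units.val_mul, map_mul, map_mul, hw1, one_mul, hσr, specVal_units_map,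
      hru, Units.val_mk0, map_zpow₀, ← sq] at h
    exact h
  have hzpow : specVal v (algebraMap (v.adicCompletion K) (AlgebraicClosure (v.adicCompletion K)) q)
      ^ (n * (p : ℕ) : ℤ) =
      specVal v (algebraMap (v.adicCompletion K) (AlgebraicClosure (v.adicCompletion K)) q)
        ^ ((2 : ℕ) : ℤ) := by
    rw [zpow_mul, zpow_natCast, zpow_natCast, ← hval, ← pow_mul, pow_mul', hrv]
  have h2 : n * (p : ℕ) = ((2 : ℕ) : ℤ) := zpow_specVal_injective hq0 hq1 hzpow
  have hdvd : (p : ℤ) ∣ 2 := ⟨n, by rw [mul_comm]; exact_mod_cast h2.symm⟩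
  have hp2' : p ∣ 2 := by exact_mod_cast hdvd
  exact hp2 ((Nat.prime_dvd_prime_iff_eq hp.out Nat.prime_two).mp hp2')

end Units

end Summit.BirchSwinnertonDyer.Rank1Residual.Iwasawa.TateUnits

end
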